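import Mathlib
import HarnessLib

/-!
# Markman 2025 — §7.3 «Semiregular `μ_r`-twisted sheaves»: the Čech-cocycle bookkeeping of p. 41 L62–63, REMARK 7.3.2
# and CONSTRUCTION 7.3.3, the same normalization in LEMMA 9.3.6 Steps 2–3 (the descended sheaf `B` on `Y`), and the
# determinant line of §7.4.2 Step 6 — AS PRINTED, kernel-checked

E. Markman: [M] *Cycles on abelian 2n-folds of Weil type from secant sheaves on abelian n-folds*,
arXiv:2502.03415 **v2** (2025-06-08), bib `Markman2025SecantWeil` — UNREFEREED PREPRINT. «p. N L m» = PyMuPDF line `m`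
of page `N` of the public v2 PDF (sha256/16 `8155aa33870069b8`), read at seat lit-w-markman g20 (pub-hsemireg LIT-W,
2026-08-24): p. 41 L59 – p. 42 L63 and p. 85 L41 – p. 86 L21 BY EYE on the renders `r_mar25v2_p41_bottom.png`,
`r_mar25v2_p42_full.png`, `r_mar25v2_p85_step2.png`, `r_mar25v2_p86_top.png` in `HOME/lit/Markman-renders-litw-markman-g20/`
(§7.4.2 Step 6 by eye at seat g19, sheet `LOCATOR-SHEET-MARKMAN.md` §58; this file: §65). Companion of `TwistedSheafKappaClass.lean`
(Def. 7.3.6 and §7.4.2 Steps 2–4 at the level of CLASSES); this file does the GLUING-DATA level: what it means for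
`B = ({E_i}, {φ_ij})` to be twisted by a `μ_r`-valued Čech 2-cocycle `θ`, why its determinant is untwisted, and the
displayed cochain computations of Remark 7.3.2 / Construction 7.3.3. Rows M-Mk4 / M-Mk9 of the LIT-W table (the
«twisted sheaves on gerbes» door of W1).

## What is printed (verbatim, v2)

* p. 41 L59–63: «7.3. Semiregular `μ_r`-twisted sheaves. We refer to [Ca1] for basic facts about twisted sheaves. Let
  `𝒰 := {U_i}_{i∈I}` be an open covering of `M`. Let `B` be a coherent sheaf of non-zero rank `r` over `M` twisted by a
  Čech cocycle `θ̃` in `Z²(𝒰, μ_r)`, where `μ_r` is the local system of `r`-th roots of unity. The `θ̃`-twisted sheaf `B`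
  has a well defined untwisted determinant line-bundle `∧^r B`, since `(θ̃_ijk)^r = 1`.»
* REMARK 7.3.2 (p. 42 L12–26): «Keep the notation of Example 7.3.1. If the characteristic class `θ` of the projective
  bundle `B` has order `ρ` in `H²(M, μ_r)`, then `ρ` divides `r`. Set `k = r/ρ`. The short exact sequence
  `0 → μ_ρ → μ_r →(•)^ρ→ μ_k → 0` yields exactness of `H²(M, μ_ρ) → H²(M, μ_r) →(•)^ρ→ H²(M, μ_k)`. Hence, `θ` is the
  image of a class `θ′ ∈ H²(M, μ_ρ)`. Let `θ̃′` be a Čech 2-cocycle with coefficients in `μ_ρ`, which is cohomologous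
  in `Z²(𝒰, μ_r)` to the cocycle `θ̃` in Example 7.3.1, `θ̃′ = θ̃δ(α)`, for a Čech 1-co-chain `α` with coefficients in
  `μ_r`. Multiplying the gluing transformations of `B` by the co-chain `α` we get the `θ̃′`-twisted sheaf `B′`, still
  with trivial determinant, with `ℙ(B′) ≅ ℙ(B) ≅ B`. We can thus choose the Čech 2-cocycle `θ̃` in Example 7.3.1 to
  have coefficients in `μ_ρ`.»
* CONSTRUCTION 7.3.3 (p. 42 L27–60): «Let `E` be a coherent sheaf of rank `r > 0` over `M`. Let `𝒰 := {U_i}_{i∈I}` be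
  an open covering, in the analytic topology, with each `U_i` biholomorphic to a polydisc and with simply connected
  finite intersections. Denote by `E_i` the restriction of `E` to `U_i` and let `ψ_i : ∧^r E_i ≅ 𝒪_{U_i}` be a
  trivialization of the determinant line bundle. The line bundle `∧^r E` is represented by the Čech cocycle
  `η_ij := (ψ_i)|_{U_ij} ∘ (ψ_j)⁻¹|_{U_ij}`. Choose an `r`-th root `η̃_ij` of the invertible holomorphic function
  `η_ij`. Let `φ_ij : (E_j)|_{U_ij} = E|_{U_ij} → E|_{U_ij} = (E_i)|_{U_ij}` be multiplication by `η̃_ij⁻¹`. Then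
  `θ_ijk := (η̃_ij η̃_jk η̃_ki)⁻¹` is a Čech cocycle `θ` in `Z²(𝒰, μ_r)` and `B := ({E_i}, {φ_ij})` is a `θ`-twisted
  sheaf. The line bundle `∧^r B` is trivial, as its transition functions are
  `η̃_ij^{−r} ψ_i ∘ ψ_j⁻¹ = (ψ_j ∘ ψ_i⁻¹) ∘ ψ_i ∘ ψ_j⁻¹ = 1`. … If the class `[θ] ∈ H²(X, μ_r)` has order `ρ`, then
  `ρ` divides `r` and we may assume that the co-cycle `θ` has coefficients in the local system `μ_ρ ⊂ μ_r`, by the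
  construction in Remark 7.3.2. The above construction goes through more generally for a twisted sheaf
  `E = ({E_i}, ϕ_ij)`, by a cocycle `θ′ ∈ Z²(𝒰, μ_r)`, in which case the resulting sheaf `B := ({E_i}, ϕ_ij η̃_ij⁻¹)`
  with a trivial determinant line bundle is `θ′θ`-twisted.»
* LEMMA 9.3.6 (p. 85 L3–5): «There exists a reflexive sheaf `B` over `Y` twisted by a 2-cocycle with coefficients in `μ_r`
  and with trivial determinant, which is locally free over `Y₀` and such that `ℙ(ι^*B) ≅ 𝔅`.» Proof, STEP 2 (p. 85 L41 –
  p. 86 L10): «We change the gluing transformations of the twisted sheaf `B′` by a 1-cochain with coefficients in `𝒪^×_Y`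
  to obtain a twisted sheaf `B` twisted by a 2-cocycle with coefficients in `μ_r`. Choose trivializations
  `ψ_i : det(B′_i) → 𝒪_{U_i}`. … We get the holomorphic functions `η_ij := ψ_i ∘ det(ρ_ij) ∘ ψ_j⁻¹` over `V_ij`. We have
  `η_ij η_jk η_ki = ψ_i ∘ det(ρ_ij)ψ_j⁻¹ψ_j ∘ det(ρ_jk)ψ_k⁻¹ψ_k ∘ det(ρ_ki)ψ_i⁻¹ = ψ_i det(ρ_ij ρ_jk ρ_ki)ψ_i⁻¹ = det(ρ_ij ρ_jk ρ_ki)`.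
  Choose `r`-th roots `η̃_ij` of `η_ij` (…). Set `ρ″_ij := η̃_ij⁻¹ρ_ij`. Then `ρ″_ij ρ″_jk ρ″_ki = (η̃_ij η̃_jk η̃_ki)⁻¹ρ_ij ρ_jk ρ_ki`
  is again a holomorphic invertible function times the identity automorphism, and (9.3.2)
  `det(ρ″_ij) det(ρ″_jk) det(ρ″_ki) = (η̃_ij η̃_jk η̃_ki)^{−r} det(ρ_ij ρ_jk ρ_ki) = (η_ij η_jk η_ki)⁻¹ det(ρ_ij ρ_jk ρ_ki) = 1`.
  Hence, `ρ″_ij ρ″_jk ρ″_ki = θ_ijk 𝟙`, where `𝟙` is the identity endomorphism of `B′_i|V_ijk` and the 2-cocycle `{θ_ijk}`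
  has coefficients in `μ_r`. We set `B := {B′_i, ρ″_ij}_{i,j∈I}`.» (p. 85 L41 – p. 86 L10, the display (9.3.2) read BY
  EYE on `r_mar25v2_p85_step2.png` — the text layer truncates it —, p. 86 on `r_mar25v2_p86_top.png`) STEP 3 (p. 86
  L11–21): «The gluing transformations of `det(B) = {∧^r B′_i, det(ρ″_ij)}` satisfy the co-cycle condition, by equation
  (9.3.2). Hence, `det(B)` is an untwisted line bundle. We have the equality `ψ_i ∘ η_ij⁻¹ det(ρ_ij)) ∘ ψ_j⁻¹ = 1`, by
  definition of `η_ij`. Hence, the trivializations `ψ_i` from Step 2 of the restrictions `det(B′_i)` of `det(B)` to `V_i`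
  glue to an isomorphism `ψ : det(B) → 𝒪_Y`. □» [sic: the unbalanced «)» in the last display] (Step 1, p. 85 L6–40:
  `B′_i := q_{i,*}(E_i)` glued by `ρ_ij` from the `G^∨`-linearization, with «`ρ_ij ρ_jk ρ_ki` is an invertible holomorphic
  function times the identity automorphism, since `g_ij g_jk g_ki` is the identity in `Ḡ`» — BY VALUE.)
* §7.4.2 Step 6 (p. 49 L31–37): «… `B` is isomorphic to `F ⊗ L`. … The untwisted line bundle `L^r` is isomorphic to
  `det(B)` …» (`F` of rank `r` with trivial determinant, `L` a twisted line bundle).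

## The model and what is proved (0 `def`, 0 named fact, 0 sorry; nothing geometric)
All statements are about gluing data on ONE fixed (triple) overlap, restrictions suppressed: `R` a commutative ring
(holomorphic functions on `U_ijk`), gluings `φ ∈ Mat_{r×r}(R)` (a local frame of the `E_i` chosen — the `U_i` are
polydiscs), a `θ`-TWISTED COCYCLE CONDITION `φ_ij φ_jk φ_ki = θ_ijk · 1` with `θ_ijk ∈ R`, `θ_ijk^r = 1`
(«coefficients in `μ_r`»), scalar cochains acting by `•`; for the pure cochain identities of Construction 7.3.3 a
commutative group `K` (the nowhere-vanishing functions). PROVED: §A `det_cocycle_of_twisted` — p. 41 L62–63: the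
determinants of a `θ`-twisted cocycle of rank `r` form an honest 1-cocycle, «since `(θ̃_ijk)^r = 1`»
(`det(θ·1) = θ^r`); §B REMARK 7.3.2 — `addOrderOf_dvd_of_torsion` («`ρ` divides `r`»: every class of an `r`-torsion
group has order dividing `r`), `pow_rho_mem_mu_k` / `mu_rho_le_ker` (the two inclusions making
`μ_ρ → μ_r →(•)^ρ→ μ_k` a complex with `μ_ρ` inside the kernel; exactness and surjectivity BY VALUE),
`twist_by_cochain` («Multiplying the gluing transformations of `B` by the co-chain `α` we get the `θ̃′`-twisted sheaf»
with `θ̃′ = θ̃·δ(α)`, `δ(α)_ijk = α_ij α_jk α_ki`) and `det_smul_of_pow_eq_one` («still with trivial determinant»: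
`det(α·φ) = α^r det φ = det φ` for `α ∈ μ_r`); §C CONSTRUCTION 7.3.3 — `theta_pow_r` («`θ_ijk := (η̃_ij η̃_jk η̃_ki)⁻¹` is
a Čech cocycle in `Z²(𝒰, μ_r)`»: `θ^r = 1` from `η̃^r = η = ψ_iψ_j⁻¹`), `det_B_transition` (the display
«`η̃_ij^{−r} ψ_i ∘ ψ_j⁻¹ = (ψ_j ∘ ψ_i⁻¹) ∘ ψ_i ∘ ψ_j⁻¹ = 1`»), `B_twisted` («`B := ({E_i}, {φ_ij})` is a `θ`-twisted
sheaf» for an untwisted `E`, and the «more generally» clause: `E` `θ′`-twisted ⇒ `B` `θ′θ`-twisted); §D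
`det_twist_line` (§7.4.2 Step 6 / Construction 7.3.3: `det(F ⊗ L) = det(F)·L^r` on gluings — `det(l·φ) = l^r·det φ`);
§E LEMMA 9.3.6 Steps 2–3 for the descended sheaf on `Y` (the `B` of Lemma 9.3.11), in the commutative group `K` with
`d_ij` standing for `det(ρ_ij)` (multiplicativity of `det` = Mathlib `Matrix.det_mul`, BY VALUE at this level):
`eta_cocycle_936` (the display `η_ij η_jk η_ki = det(ρ_ij ρ_jk ρ_ki)`), `eq_932` ((9.3.2) from `η̃_ij^r = η_ij` and
`det(ρ″_ij) = η̃_ij^{−r} det(ρ_ij)`), `theta_pow_r_of_932` («the 2-cocycle `{θ_ijk}` has coefficients in `μ_r`»: at the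
matrix level, a `θ`-twisted cocycle whose determinants satisfy (9.3.2) has `θ^r = 1` — §A read backwards), and
`step3_glue` («`ψ_i ∘ η_ij⁻¹ det(ρ_ij) ∘ ψ_j⁻¹ = 1`, by definition of `η_ij`»).
BY VALUE (not modelled): sheaves, coverings, refinement, Lemma 9.3.6 Step 1 (the `G^∨`-linearization gluings), `δ` on cochains beyond the displayed triple products,
Example 7.3.1 (lifting projective bundles, (7.3.1)), the exactness/surjectivity in Remark 7.3.2's sequence, [Ca1].
Nothing here says that Conjecture 7.3.9 holds beyond the printed cases, that any object of the pub-hsemireg cell is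
semiregular, or that HC / HC_CM / HC_AV is proved.
-/

namespace Literature.AlgebraicGeometry.Markman2025.Construction733

open Matrix

/-! ### §A — p. 41 L62–63: a `θ`-twisted sheaf has an untwisted determinant -/

section Twisted

variable {R : Type*} [CommRing R] {r : ℕ}

/-- «The `θ̃`-twisted sheaf `B` has a well defined untwisted determinant line-bundle `∧^r B`, since `(θ̃_ijk)^r = 1`.» — if
the rank-`r` gluings satisfy the twisted cocycle condition `φ_ij φ_jk φ_ki = θ·1` with `θ^r = 1`, their determinants
satisfy the honest cocycle condition `det φ_ij · det φ_jk · det φ_ki = 1`.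
[cite: Markman2025SecantWeil, §7.3 p. 41 L59–63] -/
theorem det_cocycle_of_twisted (φij φjk φki : Matrix (Fin r) (Fin r) R) (θ : R)
    (hcoc : φij * φjk * φki = θ • (1 : Matrix (Fin r) (Fin r) R)) (hθ : θ ^ r = 1) :
    φij.det * φjk.det * φki.det = 1 := by
  rw [← det_mul, ← det_mul, hcoc, det_smul, det_one, mul_one, Fintype.card_fin, hθ]

/-- In general (no hypothesis on `θ`) the determinant cochain of a `θ`-twisted rank-`r` cocycle is `θ^r`-twisted.
[cite: Markman2025SecantWeil, §7.3 p. 41 L59–63] -/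
theorem det_cocycle_twist (φij φjk φki : Matrix (Fin r) (Fin r) R) (θ : R)
    (hcoc : φij * φjk * φki = θ • (1 : Matrix (Fin r) (Fin r) R)) :
    φij.det * φjk.det * φki.det = θ ^ r := by
  rw [← det_mul, ← det_mul, hcoc, det_smul, det_one, mul_one, Fintype.card_fin]

end Twisted

/-! ### §B — REMARK 7.3.2 -/

section Remark732

/-- «If the characteristic class `θ` of the projective bundle `B` has order `ρ` in `H²(M, μ_r)`, then `ρ` divides `r`.»
— `H²(M, μ_r)` is an `r`-torsion group (`μ_r` is killed by `r`), and in an additive group every element `x` with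
`r·x = 0` has order dividing `r`. [cite: Markman2025SecantWeil, Remark 7.3.2, p. 42 L12–13] -/
theorem addOrderOf_dvd_of_torsion {H : Type*} [AddCommGroup H] {r : ℕ} (x : H) (hx : r • x = 0) :
    addOrderOf x ∣ r :=
  addOrderOf_dvd_of_nsmul_eq_zero hx

variable {K : Type*} [CommMonoid K]

/-- «Set `k = r/ρ`. The short exact sequence `0 → μ_ρ → μ_r →(•)^ρ→ μ_k → 0` …» — the `ρ`-th power maps `μ_r` into
`μ_k` when `r = ρk`: `x^r = 1 ⇒ (x^ρ)^k = 1`. (Surjectivity onto `μ_k` — enough roots of unity — is BY VALUE.)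
[cite: Markman2025SecantWeil, Remark 7.3.2, p. 42 L13–19] -/
theorem pow_rho_mem_mu_k {r ρ k : ℕ} (hr : r = ρ * k) (x : K) (hx : x ^ r = 1) : (x ^ ρ) ^ k = 1 := by
  rw [← pow_mul, ← hr, hx]

/-- … and `μ_ρ` lies in its kernel and inside `μ_r`: `x^ρ = 1 ⇒ x^r = 1` for `r = ρk`.
[cite: Markman2025SecantWeil, Remark 7.3.2, p. 42 L13–19] -/
theorem mu_rho_le_ker {r ρ k : ℕ} (hr : r = ρ * k) (x : K) (hx : x ^ ρ = 1) : x ^ r = 1 := by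
  rw [hr, pow_mul, hx, one_pow]

variable {R : Type*} [CommRing R] {r : ℕ}

/-- «`θ̃′ = θ̃δ(α)`, for a Čech 1-co-chain `α` with coefficients in `μ_r`. Multiplying the gluing transformations of `B`
by the co-chain `α` we get the `θ̃′`-twisted sheaf `B′`» — on a triple overlap: if `φ_ij φ_jk φ_ki = θ·1` then
`(α_ij φ_ij)(α_jk φ_jk)(α_ki φ_ki) = (θ·α_ij α_jk α_ki)·1`, i.e. `B′` is `θ̃·δ(α)`-twisted with
`δ(α)_ijk = α_ij α_jk α_ki`. [cite: Markman2025SecantWeil, Remark 7.3.2, p. 42 L20–25] -/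
theorem twist_by_cochain (φij φjk φki : Matrix (Fin r) (Fin r) R) (θ αij αjk αki : R)
    (hcoc : φij * φjk * φki = θ • (1 : Matrix (Fin r) (Fin r) R)) :
    (αij • φij) * (αjk • φjk) * (αki • φki) = (θ * (αij * αjk * αki)) • (1 : Matrix (Fin r) (Fin r) R) := by
  rw [smul_mul_smul_comm, smul_mul_smul_comm, hcoc, smul_smul, mul_comm (αij * αjk * αki) θ]

/-- «… still with trivial determinant» — multiplying a gluing by `α ∈ μ_r` does not change its determinant:
`det(α·φ) = α^r det φ = det φ`. [cite: Markman2025SecantWeil, Remark 7.3.2, p. 42 L23–25] -/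
theorem det_smul_of_pow_eq_one (φ : Matrix (Fin r) (Fin r) R) (α : R) (hα : α ^ r = 1) :
    (α • φ).det = φ.det := by
  rw [det_smul, Fintype.card_fin, hα, one_mul]

end Remark732

/-! ### §C — CONSTRUCTION 7.3.3 -/

section Construction

variable {K : Type*} [CommGroup K] {r : ℕ}

/-- «Then `θ_ijk := (η̃_ij η̃_jk η̃_ki)⁻¹` is a Čech cocycle `θ` in `Z²(𝒰, μ_r)`» — its values are `r`-th roots of unity:
with `η̃_ij^r = η_ij = ψ_i ψ_j⁻¹` (and cyclically), `θ_ijk^r = ((ψ_iψ_j⁻¹)(ψ_jψ_k⁻¹)(ψ_kψ_i⁻¹))⁻¹ = 1`.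
[cite: Markman2025SecantWeil, Construction 7.3.3, p. 42 L30–38] -/
theorem theta_pow_r (ψi ψj ψk ηij ηjk ηki : K) (hij : ηij ^ r = ψi * ψj⁻¹) (hjk : ηjk ^ r = ψj * ψk⁻¹)
    (hki : ηki ^ r = ψk * ψi⁻¹) : ((ηij * ηjk * ηki)⁻¹) ^ r = 1 := by
  rw [inv_pow, mul_pow, mul_pow, hij, hjk, hki]
  group

/-- «The line bundle `∧^r B` is trivial, as its transition functions are
`η̃_ij^{−r} ψ_i ∘ ψ_j⁻¹ = (ψ_j ∘ ψ_i⁻¹) ∘ ψ_i ∘ ψ_j⁻¹ = 1`.» [cite: Markman2025SecantWeil, Construction 7.3.3,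
p. 42 L39–46] -/
theorem det_B_transition (ψi ψj ηij : K) (hij : ηij ^ r = ψi * ψj⁻¹) :
    (ηij ^ r)⁻¹ * (ψi * ψj⁻¹) = 1 ∧ (ηij ^ r)⁻¹ = ψj * ψi⁻¹ := by
  rw [hij]
  constructor <;> group

variable {R : Type*} [CommRing R]

/-- «`B := ({E_i}, {φ_ij})` is a `θ`-twisted sheaf», `φ_ij` = the gluing of `E` multiplied by `η̃_ij⁻¹`: if the gluings
`g` of `E` form a cocycle (`g_ij g_jk g_ki = 1`), the new gluings satisfy `φ_ij φ_jk φ_ki = θ_ijk·1` with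
`θ_ijk = (η̃_ij η̃_jk η̃_ki)⁻¹`; and «more generally for a twisted sheaf `E = ({E_i}, ϕ_ij)`, by a cocycle `θ′` … the
resulting sheaf `B := ({E_i}, ϕ_ij η̃_ij⁻¹)` … is `θ′θ`-twisted» (take `θ′ = 1` for the first sentence). The
`η̃` are units of `R`. [cite: Markman2025SecantWeil, Construction 7.3.3, p. 42 L35–38 and L57–60] -/
theorem B_twisted (gij gjk gki : Matrix (Fin r) (Fin r) R) (θ' : R) (ηij ηjk ηki : Rˣ)
    (hcoc : gij * gjk * gki = θ' • (1 : Matrix (Fin r) (Fin r) R)) :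
    ((↑ηij⁻¹ : R) • gij) * ((↑ηjk⁻¹ : R) • gjk) * ((↑ηki⁻¹ : R) • gki) =
      (θ' * ↑(ηij * ηjk * ηki)⁻¹) • (1 : Matrix (Fin r) (Fin r) R) := by
  rw [smul_mul_smul_comm, smul_mul_smul_comm, hcoc, smul_smul, mul_comm _ θ']
  congr 2
  rw [_root_.mul_inv_rev, _root_.mul_inv_rev, Units.val_mul, Units.val_mul]
  ring

end Construction

/-! ### §D — the determinant of a twist by a line (Construction 7.3.3 / §7.4.2 Step 6) -/

/-- «`B` is isomorphic to `F ⊗ L` … The untwisted line bundle `L^r` is isomorphic to `det(B)`» (Step 6, with `det(F)`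
trivial): on gluings, `det(l·φ) = l^r · det φ`, which is `l^r` when `det φ = 1`.
[cite: Markman2025SecantWeil, §7.4.2 Step 6, p. 49 L31–37; §7.3 Construction 7.3.3, p. 42 L39–46] -/
theorem det_twist_line {R : Type*} [CommRing R] {r : ℕ} (φ : Matrix (Fin r) (Fin r) R) (l : R) :
    (l • φ).det = l ^ r * φ.det ∧ (φ.det = 1 → (l • φ).det = l ^ r) := by
  refine ⟨by rw [det_smul, Fintype.card_fin], fun h => ?_⟩
  rw [det_smul, Fintype.card_fin, h, mul_one]

/-! ### §E — LEMMA 9.3.6, Steps 2–3: the same normalization for the descended sheaf `B′ ↦ B` on `Y` -/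

section Lemma936

variable {K : Type*} [CommGroup K] {r : ℕ}

/-- STEP 2's display «`η_ij η_jk η_ki = ψ_i ∘ det(ρ_ij)ψ_j⁻¹ψ_j ∘ det(ρ_jk)ψ_k⁻¹ψ_k ∘ det(ρ_ki)ψ_i⁻¹ = ψ_i det(ρ_ij ρ_jk ρ_ki)ψ_i⁻¹
= det(ρ_ij ρ_jk ρ_ki)`» — with `η_ij := ψ_i d_ij ψ_j⁻¹`, `d_ij = det(ρ_ij)`, the trivializations cancel in the
commutative group of nowhere-vanishing functions (and `d_ij d_jk d_ki = det(ρ_ij ρ_jk ρ_ki)` is `Matrix.det_mul`).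
[cite: Markman2025SecantWeil, proof of Lemma 9.3.6 Step 2, p. 85 L50–62] -/
theorem eta_cocycle_936 (ψi ψj ψk dij djk dki : K) :
    (ψi * dij * ψj⁻¹) * (ψj * djk * ψk⁻¹) * (ψk * dki * ψi⁻¹) = dij * djk * dki := by
  apply Additive.ofMul.injective
  simp only [ofMul_mul, ofMul_inv]
  abel

/-- (9.3.2) «`det(ρ″_ij) det(ρ″_jk) det(ρ″_ki) = (η̃_ij η̃_jk η̃_ki)^{−r} det(ρ_ij ρ_jk ρ_ki) = (η_ij η_jk η_ki)⁻¹ det(ρ_ij ρ_jk ρ_ki)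
= 1`» for `ρ″_ij := η̃_ij⁻¹ρ_ij`: with `det(ρ″_ij) = η̃_ij^{−r} d_ij` (rank `r`, `det_twist_line`) and
`η̃_ij^r = η_ij = ψ_i d_ij ψ_j⁻¹`, the product is `(η_ij η_jk η_ki)⁻¹ d_ij d_jk d_ki = 1` by the display above.
[cite: Markman2025SecantWeil, proof of Lemma 9.3.6 Step 2, (9.3.2), p. 85 L63–75] -/
theorem eq_932 (ψi ψj ψk dij djk dki eij ejk eki : K) (hij : eij ^ r = ψi * dij * ψj⁻¹)
    (hjk : ejk ^ r = ψj * djk * ψk⁻¹) (hki : eki ^ r = ψk * dki * ψi⁻¹) :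
    (eij⁻¹) ^ r * dij * ((ejk⁻¹) ^ r * djk) * ((eki⁻¹) ^ r * dki) = 1 := by
  rw [inv_pow, inv_pow, inv_pow, hij, hjk, hki]
  apply Additive.ofMul.injective
  simp only [ofMul_mul, ofMul_inv, ofMul_one]
  abel

/-- «Hence, `ρ″_ij ρ″_jk ρ″_ki = θ_ijk 𝟙`, where … the 2-cocycle `{θ_ijk}` has coefficients in `μ_r`» — at the matrix level
(gluings of rank `r` over a commutative ring): a `θ`-twisted cocycle whose determinants satisfy (9.3.2) has
`θ^r = 1` (`det(θ·1) = θ^r`; §A read backwards). [cite: Markman2025SecantWeil, proof of Lemma 9.3.6 Step 2, p. 86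
L3–10] -/
theorem theta_pow_r_of_932 {R : Type*} [CommRing R] (ρij ρjk ρki : Matrix (Fin r) (Fin r) R) (θ : R)
    (hcoc : ρij * ρjk * ρki = θ • (1 : Matrix (Fin r) (Fin r) R)) (h932 : ρij.det * ρjk.det * ρki.det = 1) :
    θ ^ r = 1 := by
  rw [← det_cocycle_twist ρij ρjk ρki θ hcoc, h932]

/-- STEP 3 «We have the equality `ψ_i ∘ η_ij⁻¹ det(ρ_ij) ∘ ψ_j⁻¹ = 1`, by definition of `η_ij`» (so the local
trivializations `ψ_i` glue to `ψ : det(B) → 𝒪_Y`). [cite: Markman2025SecantWeil, proof of Lemma 9.3.6 Step 3,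
p. 86 L11–21] -/
theorem step3_glue (ψi ψj dij ηij : K) (hη : ηij = ψi * dij * ψj⁻¹) : ψi * (ηij⁻¹ * dij) * ψj⁻¹ = 1 := by
  rw [hη]
  apply Additive.ofMul.injective
  simp only [ofMul_mul, ofMul_inv, ofMul_one]
  abel

end Lemma936

end Literature.AlgebraicGeometry.Markman2025.Construction733
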